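import Summits.QuantumFields.YangMills.Theorems.BalabanUVNodesPortS1SmallLetter
import Summits.QuantumFields.YangMills.Theorems.BalabanUVNodesPortS1JacobianLocal
import Summits.QuantumFields.YangMills.Theorems.BalabanUVNodesPortS1QtCHop
import Summits.QuantumFields.YangMills.Theorems.BalabanUVNodesPortS1JacDomLocal

/-!
# Port S1, socket (o1) leaf (o1-δ) — THE k-UNIFORM BOUND `‖h_ℂ D‖ ≤ b·‖D‖`, `b = 6 ∕ (L^{1−d} − 157α)`, ON DEF-1's `hopLinGraphC`

Cell `ym-nodeO-ideate`, porter seat PT-A-1 (gen 9); `--kind proof --supports stmt-QuantumFields-27930 --as helper`; count-neutral.  [I] = [Balaban1987RG1]; [B7AVG] = [Balaban1985Averaging].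

WHY.  Lit ✓`B12Lineariz267.exists_Dt` (instantiated at the record in (o1-ε) ✓`exists_recordDt`) carries the letter `hHop : ∀ X, ‖hop X‖ ≤ b‖X‖`; the radius of `D̃` is `min (R∕3) (1∕(18C₂(b+1)))`.
For the radius to be UNIFORM IN `k` (print: all constants depend on `d, L` only) `b` must not depend on the volume or on `k`.  This file proves such a bound from N07's quantitative central-response
estimate ✓`norm_centralResponse_sub_le` («the response is `(1 − m∕|I|)·X + O(157α)·X`», `1 − m∕|I| = L^{1−d}` by ✓`offCentral_ratio_eq`): each `3 × 3` block `A₁(c)` of `LQ̃` restricted to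
the `b₀`-variables is bounded BELOW by `(L^{1−d} − 157α)∕3` in the sup norm, hence its inverse (real and imaginary parts separately) by `3∕(L^{1−d} − 157α)`, and `h_ℂ` by twice that.

WHAT IS PROVED.
* §1 (general `SU(N)`, one coarse bond) ★★ `norm_centralResponse_ge` — `(L^{1−d} − 157α)·‖Y‖ ≤ ‖D(W ↦ avgM W c)(↑U)[U(β(c))·Y·δ_{β(c)}]‖` for `Y ∈ 𝔰𝔲(N)`, loops at `c` within `α ≤ 1∕24`,
  `α < δ_N` of `1` (the estimate half of ✓`centralResponse_onto_of_lt`, rearranged instead of concluded).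
* §2 (the record, `SU(2)`) `recordLQt_bondVec_eq` (ed.15 `LQ̃` on a one-bond coordinate vector = the response times `Ū(c)⋆`, ✓`recordLQt_apply_eq_fderiv_avgM`), ★ `norm_recordLQt_bondVec_b0_ge`
  (`(L^{1−d} − 157α)·‖Σ v_a su2Gen a‖ ≤ ‖LQ̃(Vk)(v on b₀(c))(c)‖`), `abs_le_norm_sum_smul_su2Gen`, `norm_le_three_mul_of_mem_lieSU`.
* §3 ★★★ `norm_hopLinGraphC_le` — `‖hopLinGraphC Vk D‖ ≤ (6 ∕ (L^{1−d} − 157α))·‖D‖` for EVERY coarse matrix field `D`, under `dist1(loop) ≤ α ≤ 1∕24`, `157α < L^{1−d}` (the hypotheses of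
  ✓`recordB0BlockInvertible_of_loopSmall`, which supplies the letter); `b` depends on `d, L, α` ONLY — k- and volume-uniform.

HONEST FRAMING.  An operator-norm bound on DEF-1's `h_ℂ`; with (o1-ε) it makes the radius of `D̃` k-uniform; nothing of (o3), `recordFluctInt`, FE-2 is touched; `stub_FE` (XXL) ∕ `stub_P0C` OPEN,
⟨27930⟩ OPEN (1∕3); NODE O 0∕1; COUNT 8∕28 · K 1∕4 UNMOVED; finite `𝕋⁴_{L^K}` at fixed ε — NOT continuum ∕ OS; **the Yang–Mills mass gap (Clay) is NOT proved by any of this.**  No `sorry`;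
standard axioms only.
-/

noncomputable section

open scoped BigOperators Matrix.Norms.L2Operator Topology

open Set Metric Filter

namespace Summit.QuantumFields.YangMills.Theorems.BalabanUVNodesPortS1

open Summit.QuantumFields.YangMills.Theorems.K0RecordFormatNames
open Summit.QuantumFields.YangMills.BalabanUVNodes
open Literature.MathematicalPhysics.QuantumFieldTheory.Balaban1983to89
open Literature.MathematicalPhysics.QuantumFieldTheory.Balaban1983to89.Node00
open Literature.MathematicalPhysics.QuantumFieldTheory.Balaban1983to89.T4Continuum (T4Family)
open Literature.MathematicalPhysics.QuantumFieldTheory.Balaban1983to89.BlockAveraging (avgFun loopHol Small Idx)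
open Literature.MathematicalPhysics.QuantumFieldTheory.Balaban1983to89.BlockAveragingHaarAC (centralBond pre post openHol IsCentral)
open Literature.MathematicalPhysics.QuantumFieldTheory.Balaban1983to89.ExpMeanLog (eml expMeanLogSU deltaSU)
open Literature.MathematicalPhysics.QuantumFieldTheory.Balaban1983to89.T4AdjointCovarianceUnitary (lieSU mem_lieSU_iff conj_mem_lieSU)
open Summit.QuantumFields.YangMills.BalabanUVNodes.N07CentralResponseNormalForm
  (norm_centralResponse_sub_le normalForm_family_self fderiv_avgM_single_centralBond_eq_normalForm)
open Summit.QuantumFields.YangMills.Theorems.Prop7FibreVelocity (offCentral_ratio_eq)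
open NormedSpace (exp)
open _root_.Matrix

/-! ## §1  The quantitative central response (general `SU(N)`) -/

section Response

variable {P : Params} {j : ℕ} {N : ℕ} [NeZero N]

/-- ★★ **THE CENTRAL RESPONSE IS BOUNDED BELOW**: with the (0.4) loop variables of `U` at `c` within `α ≤ 1∕24`, `α < δ_N` of `1`, for every `Y ∈ 𝔰𝔲(N)`,
`(L^{1−d} − 157α)·‖Y‖ ≤ ‖D(W ↦ avgM W c)(↑U)[U(β(c))·Y·δ_{β(c)}]‖` — [B7AVG] (0.8): the response pulled back by `Ū(c)⋆` is `(1 − m∕|I|)·X + O(157α)·X` with `X = uYu⋆` (`‖X‖ = ‖Y‖`) and `1 − m∕|I| = L^{1−d}`.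
[cite: Balaban1985Averaging, Prop. 3 (122)–(124) p.36; Balaban1987RG1, (0.4), (0.8) p.253] -/
theorem norm_centralResponse_ge (hj : j + 1 ≤ P.m + P.K) (U : GaugeField P j (SU N)) (c : PBond P (j + 1)) {α : ℝ}
    (hα : ∀ i, dist1 (loopHol U c i) ≤ α) (hα24 : α ≤ 1 / 24) (hαδ : α < deltaSU (Fin N)) (Y : lieSU (Fin N)) :
    (((P.L : ℝ) ^ (P.d - 1))⁻¹ - 157 * α) * ‖(Y : Matrix (Fin N) (Fin N) ℂ)‖ ≤
      ‖fderiv ℝ (fun W : PBond P j → Matrix (Fin N) (Fin N) ℂ => avgM W c) (coeField U)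
        (Pi.single (centralBond c) (((U (centralBond c) : SU N) : Matrix (Fin N) (Fin N) ℂ) * (Y : Matrix (Fin N) (Fin N) ℂ)))‖ := by
  haveI : Nonempty (Fin N) := ⟨⟨0, Nat.pos_of_ne_zero (NeZero.ne N)⟩⟩
  have hα0 : 0 ≤ α := (GaugeGroup.dist1_nonneg _).trans (hα (Classical.arbitrary _))
  have hsmall : Small (expMeanLogSU (n := Fin N)) U c := fun i => lt_of_le_of_lt (hα i) hαδ
  set uβ : Matrix (Fin N) (Fin N) ℂ := ((U (centralBond c) : SU N) : Matrix (Fin N) (Fin N) ℂ) with huβ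
  set L : (PBond P j → Matrix (Fin N) (Fin N) ℂ) →L[ℝ] Matrix (Fin N) (Fin N) ℂ :=
    fderiv ℝ (fun W : PBond P j → Matrix (Fin N) (Fin N) ℂ => avgM W c) (coeField U) with hL
  obtain ⟨u, hu⟩ : ∃ u : Matrix (Fin N) (Fin N) ℂ, u = ((pre U c : SU N) : Matrix (Fin N) (Fin N) ℂ) * uβ := ⟨_, rfl⟩
  obtain ⟨W₀, hW₀⟩ : ∃ W₀ : Matrix (Fin N) (Fin N) ℂ,
      W₀ = ((pre U c : SU N) : Matrix (Fin N) (Fin N) ℂ) * uβ * ((post U c : SU N) : Matrix (Fin N) (Fin N) ℂ) := ⟨_, rfl⟩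
  obtain ⟨Xm, hXm⟩ : ∃ Xm : Matrix (Fin N) (Fin N) ℂ, Xm = u * (Y : Matrix (Fin N) (Fin N) ℂ) * star u := ⟨_, rfl⟩
  have hu1 : star u * u = 1 := by rw [hu, huβ, ← Submonoid.coe_mul]; exact star_coe_mul_coe_SU _
  have huu : u * star u = 1 := by rw [hu, huβ, ← Submonoid.coe_mul]; exact coe_mul_star_coe_SU _
  have hW₀u : W₀ * star W₀ = 1 := by rw [hW₀, huβ, ← Submonoid.coe_mul, ← Submonoid.coe_mul]; exact coe_mul_star_coe_SU _
  have hW₀u' : star W₀ * W₀ = 1 := by rw [hW₀, huβ, ← Submonoid.coe_mul, ← Submonoid.coe_mul]; exact star_coe_mul_coe_SU _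
  have hXskew : star Xm = -Xm := by
    rw [hXm]
    simp only [star_mul, star_star, star_coe_lieSU, neg_mul, mul_neg, mul_assoc]
  have hpu1 : star (((pre U c : SU N) : Matrix (Fin N) (Fin N) ℂ) * uβ) * (((pre U c : SU N) : Matrix (Fin N) (Fin N) ℂ) * uβ) = 1 := by
    rw [← hu]; exact hu1
  have hXW : ((pre U c : SU N) : Matrix (Fin N) (Fin N) ℂ) * (uβ * (Y : Matrix (Fin N) (Fin N) ℂ)) * ((post U c : SU N) : Matrix (Fin N) (Fin N) ℂ) = Xm * W₀ := by
    rw [hXm, hW₀, hu]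
    calc ((pre U c : SU N) : Matrix (Fin N) (Fin N) ℂ) * (uβ * (Y : Matrix (Fin N) (Fin N) ℂ)) * ((post U c : SU N) : Matrix (Fin N) (Fin N) ℂ)
        = ((pre U c : SU N) : Matrix (Fin N) (Fin N) ℂ) * uβ * (Y : Matrix (Fin N) (Fin N) ℂ) *
            (star (((pre U c : SU N) : Matrix (Fin N) (Fin N) ℂ) * uβ) * (((pre U c : SU N) : Matrix (Fin N) (Fin N) ℂ) * uβ)) *
            ((post U c : SU N) : Matrix (Fin N) (Fin N) ℂ) := by rw [hpu1]; noncomm_ring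
      _ = _ := by noncomm_ring
  have hh : ∀ i, ¬ IsCentral c i → ‖((openHol U c i : SU N) : Matrix (Fin N) (Fin N) ℂ) * star W₀ - 1‖ ≤ α := fun i hc => by
    rw [hW₀, huβ, normalForm_family_self hj U c i hc, ← FederbushMean.dist1_SU_eq]; exact hα i
  have hest := norm_centralResponse_sub_le (IsCentral c) (fun i => ((openHol U c i : SU N) : Matrix (Fin N) (Fin N) ℂ)) W₀ Xm hα0 hα24 hh hW₀u hXskew
  have hRΦ := fderiv_avgM_single_centralBond_eq_normalForm hj U c hsmall Y
  rw [hXW] at hRΦ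
  rw [← huβ, ← hL, ← hW₀] at hRΦ
  rw [← hRΦ] at hest
  -- norms of the unitary factors
  have hsW₀ : star W₀ ∈ unitary (Matrix (Fin N) (Fin N) ℂ) := Unitary.mem_iff.2 ⟨by rw [star_star]; exact hW₀u, by rw [star_star]; exact hW₀u'⟩
  have hsu : star u ∈ unitary (Matrix (Fin N) (Fin N) ℂ) := Unitary.mem_iff.2 ⟨by rw [star_star]; exact huu, by rw [star_star]; exact hu1⟩
  have huU : u ∈ unitary (Matrix (Fin N) (Fin N) ℂ) := Unitary.mem_iff.2 ⟨hu1, huu⟩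
  set R : Matrix (Fin N) (Fin N) ℂ := L (Pi.single (centralBond c) (uβ * (Y : Matrix (Fin N) (Fin N) ℂ))) with hR
  have hRn : ‖R * star W₀‖ = ‖R‖ := CStarRing.norm_mul_mem_unitary R hsW₀
  have hXmY : ‖Xm‖ = ‖(Y : Matrix (Fin N) (Fin N) ℂ)‖ := by
    rw [hXm, mul_assoc, CStarRing.norm_mem_unitary_mul _ huU, CStarRing.norm_mul_mem_unitary _ hsu]
  -- the off-central fraction
  set m : ℕ := (Finset.univ.filter fun i => ¬ IsCentral c i).card with hm
  have hsm : ‖(((m : ℂ)) / (Fintype.card (Idx P) : ℂ)) • Xm‖ = (m : ℝ) / Fintype.card (Idx P) * ‖Xm‖ := by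
    rw [norm_smul, norm_div, Complex.norm_natCast, Complex.norm_natCast]
  have hratio : (m : ℝ) / Fintype.card (Idx P) = 1 - ((P.L : ℝ) ^ (P.d - 1))⁻¹ := by rw [hm]; exact offCentral_ratio_eq c
  -- triangle inequality
  have hdecomp : Xm = (R * star W₀ + (((m : ℂ)) / (Fintype.card (Idx P) : ℂ)) • Xm) - (R * star W₀ - Xm + (((m : ℂ)) / (Fintype.card (Idx P) : ℂ)) • Xm) := by abel
  have htri : ‖Xm‖ ≤ ‖R * star W₀‖ + ‖(((m : ℂ)) / (Fintype.card (Idx P) : ℂ)) • Xm‖ + ‖R * star W₀ - Xm + (((m : ℂ)) / (Fintype.card (Idx P) : ℂ)) • Xm‖ := by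
    calc ‖Xm‖ = ‖(R * star W₀ + (((m : ℂ)) / (Fintype.card (Idx P) : ℂ)) • Xm) - (R * star W₀ - Xm + (((m : ℂ)) / (Fintype.card (Idx P) : ℂ)) • Xm)‖ := by
          rw [← hdecomp]
      _ ≤ ‖R * star W₀ + (((m : ℂ)) / (Fintype.card (Idx P) : ℂ)) • Xm‖ + ‖R * star W₀ - Xm + (((m : ℂ)) / (Fintype.card (Idx P) : ℂ)) • Xm‖ := norm_sub_le _ _
      _ ≤ _ := by gcongr; exact norm_add_le _ _
  rw [hRn, hsm] at htri
  rw [hXmY] at htri hest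
  rw [hratio] at htri
  nlinarith [htri, hest, norm_nonneg (Y : Matrix (Fin N) (Fin N) ℂ), norm_nonneg R]

end Response

/-! ## §2  At the record: `LQ̃` on one-bond coordinate vectors, and the block lower bound -/

variable (F : T4Family)

open Classical in
/-- Ed.15's `LQ̃(Vk)` on the coordinate vector supported on the bond `β` with colour coefficients `v` is the one-step response to `(Σ v_a su2Gen a)·Vk(β)·δ_β`, times `Ū(c)⋆` (✓`recordLQt_apply_eq_fderiv_avgM`).
[cite: Balaban1987RG1, p.267 («L is a linear transformation»), (2.4) p.266] -/
theorem recordLQt_bondVec_eq (k K : ℕ) (hk : k + 1 ≤ (F.P K).m + (F.P K).K) (Vk : GaugeField (F.P K) k (SU 2))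
    (hsmall : ∀ c : PBond (F.P K) (k + 1), Small expMeanLogSU Vk c) (β : PBond (F.P K) k) (v : Fin 3 → ℝ) (c : PBond (F.P K) (k + 1)) :
    recordLQt F k K Vk (fun i : FluctIdx F k K => if i.1 = β then v i.2 else 0) c =
      fderiv ℝ (fun W : PBond (F.P K) k → MatA 2 => avgM W c) (coeField Vk)
          (Pi.single β ((∑ a, ((v a : ℝ) : ℂ) • su2Gen a) * ((Vk β : SU 2) : MatA 2))) *
        star (((avgFun expMeanLogSU Vk c : SU 2) : MatA 2)) := by
  rw [recordLQt_apply_eq_fderiv_avgM F k K hk Vk hsmall]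
  congr 2
  funext b
  rw [fluctMat_bondVec]
  by_cases hb : b = β
  · subst hb; simp
  · simp [hb]

/-- `|v_j| ≤ ‖Σ_a v_a su2Gen a‖` (the coordinates of an 𝔰𝔲(2) matrix are bounded by its norm). [folklore] -/
theorem abs_le_norm_sum_smul_su2Gen (v : Fin 3 → ℝ) (j : Fin 3) : |v j| ≤ ‖∑ a, ((v a : ℝ) : ℂ) • su2Gen a‖ := by
  have h := norm_su2CoordCt_le (∑ a, ((v a : ℝ) : ℂ) • su2Gen a) j
  rw [su2CoordCt_of_mem_lieSU (sum_smul_su2Gen_mem_lieSU v), su2Coord_sum_smul_su2Gen, Complex.norm_real, Real.norm_eq_abs] at h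
  exact h

/-- `‖M‖ ≤ 3·t` for `M ∈ 𝔰𝔲(2)` whose coordinates are bounded by `t` (`M = Σ_a (su2Coord M a) su2Gen a`, `‖su2Gen a‖ = 1`). [folklore] -/
theorem norm_le_three_mul_of_mem_lieSU {M : MatA 2} (hM : M ∈ lieSU (Fin 2)) {t : ℝ} (ht : ∀ j, |su2Coord M j| ≤ t) : ‖M‖ ≤ 3 * t := by
  rw [← sum_su2Coord_smul_su2Gen hM]
  calc ‖∑ a, ((su2Coord M a : ℝ) : ℂ) • su2Gen a‖ ≤ ∑ a, ‖((su2Coord M a : ℝ) : ℂ) • su2Gen a‖ := norm_sum_le _ _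
    _ ≤ ∑ _a : Fin 3, t := Finset.sum_le_sum fun a _ => by
        rw [norm_smul, norm_su2Gen, mul_one, Complex.norm_real, Real.norm_eq_abs]; exact ht a
    _ = 3 * t := by simp

open Classical in
/-- ★ **THE `b₀`-BLOCK OF `LQ̃(Vk)` IS BOUNDED BELOW**: `(L^{1−d} − 157α)·‖Σ v_a su2Gen a‖ ≤ ‖LQ̃(Vk)(v on b₀(c))(c)‖` — §1 at `Y = Vk(b₀)⋆·(Σ v_a su2Gen a)·Vk(b₀) ∈ 𝔰𝔲(2)` (same norm), the factor
`Ū(c)⋆` being unitary. [cite: Balaban1985Averaging, Prop. 3 (124) p.36; Balaban1987RG1, p.267] -/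
theorem norm_recordLQt_bondVec_b0_ge (k K : ℕ) (hk : k + 1 ≤ (F.P K).m + (F.P K).K) (Vk : GaugeField (F.P K) k (SU 2)) {α : ℝ}
    (hα : ∀ (c : PBond (F.P K) (k + 1)) (i : Idx (F.P K)), dist1 (loopHol Vk c i) ≤ α) (hα24 : α ≤ 1 / 24) (c : PBond (F.P K) (k + 1)) (v : Fin 3 → ℝ) :
    ((((F.P K).L : ℝ) ^ ((F.P K).d - 1))⁻¹ - 157 * α) * ‖∑ a, ((v a : ℝ) : ℂ) • su2Gen a‖ ≤
      ‖recordLQt F k K Vk (fun i : FluctIdx F k K => if i.1 = recordB0 F k K c then v i.2 else 0) c‖ := by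
  have h3 : (1 : ℝ) / 3 ≤ deltaSU (Fin 2) := by
    unfold ExpMeanLog.deltaSU
    rw [Fintype.card_fin]
    exact le_min le_rfl (by push_cast; linarith [Real.pi_gt_three])
  have hαδ : α < deltaSU (Fin 2) := lt_of_le_of_lt hα24 (lt_of_lt_of_le (by norm_num) h3)
  have hsmall : ∀ c : PBond (F.P K) (k + 1), Small expMeanLogSU Vk c := fun c i => lt_of_le_of_lt (hα c i) hαδ
  set uβ : MatA 2 := ((Vk (recordB0 F k K c) : SU 2) : MatA 2) with huβ
  set Yv : MatA 2 := ∑ a, ((v a : ℝ) : ℂ) • su2Gen a with hYv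
  have hYmem : Yv ∈ lieSU (Fin 2) := sum_smul_su2Gen_mem_lieSU v
  have hu : uβ ∈ Matrix.unitaryGroup (Fin 2) ℂ := (Vk (recordB0 F k K c)).2.1
  have hY'mem : star uβ * Yv * uβ ∈ lieSU (Fin 2) := by
    have h := conj_mem_lieSU hYmem ⟨star uβ, Unitary.star_mem hu⟩
    simpa only [star_star] using h
  have key := norm_centralResponse_ge (N := 2) hk Vk c (hα c) hα24 hαδ ⟨star uβ * Yv * uβ, hY'mem⟩
  have hprod : uβ * (star uβ * Yv * uβ) = Yv * uβ := by
    calc uβ * (star uβ * Yv * uβ) = (uβ * star uβ) * Yv * uβ := by noncomm_ring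
      _ = Yv * uβ := by rw [huβ, coe_mul_star_coe_SU, one_mul]
  have huU : uβ ∈ unitary (MatA 2) := hu
  have hnormY' : ‖star uβ * Yv * uβ‖ = ‖Yv‖ := by
    rw [mul_assoc, CStarRing.norm_mem_unitary_mul _ (Unitary.star_mem huU), CStarRing.norm_mul_mem_unitary _ huU]
  have hg : star (((avgFun expMeanLogSU Vk c : SU 2) : MatA 2)) ∈ unitary (MatA 2) := Unitary.star_mem (avgFun expMeanLogSU Vk c).2.1
  rw [recordLQt_bondVec_eq F k K hk Vk hsmall, CStarRing.norm_mul_mem_unitary _ hg, ← hprod, ← hnormY']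
  exact key

/-! ## §3  ★★★ The k-uniform bound on `h_ℂ` -/

open Classical in
/-- ★★★ **`‖h_ℂ D‖ ≤ (6 ∕ (L^{1−d} − 157α))·‖D‖`** for every coarse matrix field `D`, whenever the (0.4) loop variables of `Vk` are within `α ≤ 1∕24` of `1` and `157α < L^{1−d}`: on each coarse bond `c`,
`A₁(c)·w(c, ·) = ξ(c, ·)` (`A₁ = recordLQtB0` is block-diagonal, ✓`recordLQtB0_apply_of_ne`; `ξ = coarseCoordC D`, `|ξ| ≤ ‖D‖`), the real and imaginary parts of `w(c, ·)` solve the REAL block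
equation, and §2 bounds them by `3‖D‖ ∕ (L^{1−d} − 157α)` each.  `b` depends on `d, L, α` only. [cite: Balaban1987RG1, p.267 («h(c) … an inverse of a coefficient»); Balaban1985Averaging, Prop. 3 (124) p.36] -/
theorem norm_hopLinGraphC_le (k K : ℕ) (hk : k + 1 ≤ (F.P K).m + (F.P K).K) (Vk : GaugeField (F.P K) k (SU 2)) {α : ℝ}
    (hα : ∀ (c : PBond (F.P K) (k + 1)) (i : Idx (F.P K)), dist1 (loopHol Vk c i) ≤ α) (hα24 : α ≤ 1 / 24)
    (hαL : 157 * α < (((F.P K).L : ℝ) ^ ((F.P K).d - 1))⁻¹) (D : PBond (F.P K) (k + 1) → MatA 2) :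
    ‖hopLinGraphC F k K Vk D‖ ≤ 6 / ((((F.P K).L : ℝ) ^ ((F.P K).d - 1))⁻¹ - 157 * α) * ‖D‖ := by
  have h3 : (1 : ℝ) / 3 ≤ deltaSU (Fin 2) := by
    unfold ExpMeanLog.deltaSU
    rw [Fintype.card_fin]
    exact le_min le_rfl (by push_cast; linarith [Real.pi_gt_three])
  have hαδ : α < deltaSU (Fin 2) := lt_of_le_of_lt hα24 (lt_of_lt_of_le (by norm_num) h3)
  have hsmall : ∀ c : PBond (F.P K) (k + 1), Small expMeanLogSU Vk c := fun c i => lt_of_le_of_lt (hα c i) hαδ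
  have hA : RecordB0BlockInvertible F k K Vk := recordB0BlockInvertible_of_loopSmall F k K hk Vk hα hα24 hαL
  set θ : ℝ := (((F.P K).L : ℝ) ^ ((F.P K).d - 1))⁻¹ - 157 * α with hθdef
  have hθ : 0 < θ := sub_pos.2 hαL
  set A := recordLQtB0 F k K Vk with hAdef
  set AC := recordLQtB0C F k K Vk with hACdef
  set ξ := coarseCoordC F k K D with hξdef
  set w := AC⁻¹ *ᵥ ξ with hwdef
  have hAw : AC *ᵥ w = ξ := by
    rw [hwdef, Matrix.mulVec_mulVec, Matrix.mul_nonsing_inv _ (isUnit_det_recordLQtB0C F k K Vk hA), Matrix.one_mulVec]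
  have hξ : ∀ c jj, ‖ξ (c, jj)‖ ≤ ‖D‖ := fun c jj => (norm_su2CoordCt_le (D c) jj).trans (norm_le_pi_norm D c)
  -- block reduction of `A₁^ℂ · w` at the row `(c, jj)`
  have hblock : ∀ c jj, ξ (c, jj) = ∑ j', ((A (c, jj) (c, j') : ℝ) : ℂ) * w (c, j') := by
    intro c jj
    have h := congrFun hAw (c, jj)
    rw [← h]
    simp only [Matrix.mulVec, dotProduct]
    rw [Fintype.sum_prod_type, Finset.sum_eq_single c]
    · rfl
    · intro c' _ hc'
      exact Finset.sum_eq_zero fun j' _ => by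
        rw [hACdef, recordLQtB0C_apply, recordLQtB0_apply_of_ne F k K hk Vk (Ne.symm hc'), Complex.ofReal_zero, zero_mul]
    · intro h; exact absurd (Finset.mem_univ c) h
  have hre : ∀ c jj, (ξ (c, jj)).re = ∑ j', A (c, jj) (c, j') * (w (c, j')).re := by
    intro c jj
    rw [hblock c jj, Complex.re_sum]
    exact Finset.sum_congr rfl fun j' _ => by simp [Complex.mul_re]
  have him : ∀ c jj, (ξ (c, jj)).im = ∑ j', A (c, jj) (c, j') * (w (c, j')).im := by
    intro c jj
    rw [hblock c jj, Complex.im_sum]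
    exact Finset.sum_congr rfl fun j' _ => by simp [Complex.mul_im]
  -- the real block equation bounds coordinates
  have hcoord : ∀ (c : PBond (F.P K) (k + 1)) (u : Fin 3 → ℝ), (∀ jj, |∑ j', A (c, jj) (c, j') * u j'| ≤ ‖D‖) → ∀ jj, θ * |u jj| ≤ 3 * ‖D‖ := by
    intro c u hu jj
    have h1 := abs_le_norm_sum_smul_su2Gen u jj
    have h2 := norm_recordLQt_bondVec_b0_ge F k K hk Vk hα hα24 c u
    have h3 : ‖recordLQt F k K Vk (fun i : FluctIdx F k K => if i.1 = recordB0 F k K c then u i.2 else 0) c‖ ≤ 3 * ‖D‖ := by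
      refine norm_le_three_mul_of_mem_lieSU (recordLQt_mem_lieSU_of_small F k K Vk hsmall _ c) fun j' => ?_
      rw [← b0Block_mulVec F k K Vk c u j']
      have : (Matrix.of fun j j' : Fin 3 => recordLQtB0 F k K Vk (c, j) (c, j')).mulVec u j' = ∑ j'', A (c, j') (c, j'') * u j'' := by
        simp only [Matrix.mulVec, dotProduct, Matrix.of_apply, hAdef]
      rw [this]
      exact hu j'
    have h4 : θ * |u jj| ≤ θ * ‖∑ a, ((u a : ℝ) : ℂ) • su2Gen a‖ := mul_le_mul_of_nonneg_left h1 hθ.le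
    linarith
  -- conclusion, coordinate by coordinate
  refine (pi_norm_le_iff_of_nonneg (by positivity)).2 fun i => ?_
  by_cases h : i.1 ∈ Set.range (recordB0 F k K)
  · rw [hopLinGraphC_apply_of_mem F k K Vk D i h]
    have hr := hcoord h.choose (fun j' => (w (h.choose, j')).re)
      (fun jj => by rw [← hre h.choose jj]; exact (Complex.abs_re_le_norm _).trans (hξ h.choose jj)) i.2
    have hi := hcoord h.choose (fun j' => (w (h.choose, j')).im)
      (fun jj => by rw [← him h.choose jj]; exact (Complex.abs_im_le_norm _).trans (hξ h.choose jj)) i.2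
    have hr' : |(w (h.choose, i.2)).re| ≤ 3 * ‖D‖ / θ := by rw [le_div_iff₀ hθ]; linarith
    have hi' : |(w (h.choose, i.2)).im| ≤ 3 * ‖D‖ / θ := by rw [le_div_iff₀ hθ]; linarith
    calc ‖((recordLQtB0C F k K Vk)⁻¹ *ᵥ coarseCoordC F k K D) (h.choose, i.2)‖ = ‖w (h.choose, i.2)‖ := rfl
      _ ≤ |(w (h.choose, i.2)).re| + |(w (h.choose, i.2)).im| := Complex.norm_le_abs_re_add_abs_im _
      _ ≤ 3 * ‖D‖ / θ + 3 * ‖D‖ / θ := add_le_add hr' hi'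
      _ = 6 / θ * ‖D‖ := by ring
  · rw [hopLinGraphC_apply_of_not_mem F k K Vk D i h, norm_zero]
    positivity

end Summit.QuantumFields.YangMills.Theorems.BalabanUVNodesPortS1

end
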